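import Summits.ResolutionOfSingularities.ResolutionOfSingularities.Theorems.EquisingularLiftEquisingularLiftNatDepthELNat
import Summits.ResolutionOfSingularities.ResolutionOfSingularities.Theorems.EquisingularLiftEquisingularLiftNatELNatAtOneStepPointsLinAut
import Summits.ResolutionOfSingularities.ResolutionOfSingularities.Theorems.EquisingularLiftEquisingularLiftNatSingularLocusFinite
import HarnessLib

/-!
# [OURS] THE DEPTH THEOREMS FOR A PRIME FORM, POLYNOMIAL HYPOTHESES PLUS DEPTH: finitely many singular lines + finite blow-up depth ⟹ `IsoHypPoint` / EL♮
# (cruxes `Theses.EquisingularLift.EquisingularLiftNat` / `…NatThree`, stmt-ResolutionOfSingularities-20038 / -20148; every dimension, `K = K̄`)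

[OURS · leafhand-res-equisingularlift-10 g1, 2026-08-31; cell `pub/decomp-res`] AI-produced, weaker than expert review; NOT a statement of any manuscript;
nothing here proves resolution of singularities in positive characteristic.  DEF-FREE helper; no `sorry`; standard axioms; ZERO named hypotheses.

`H = V₊(F)` for a PRIME FORM `F ∈ K[x₀, …, x_{m+2}]`: every scheme-side hypothesis of ✓ `isoHypPoint_of_finite_nonRegularLocus_tower` (p831421) /
✓ `elnatO_of_finite_nonRegularLocus_tower` (p831468) is read off the polynomial — integrality (✓ `HypersurfaceSpecimen.isIntegral_hypersurface_of_prime`),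
the locally-principal binder (✓ `HypersurfaceSpecimen.locallyPrincipal_hypersurfaceι`), FINITENESS of the non-regular locus from finitely many singular LINES
(✓ `SingLocus.finite_setOf_not_isRegularLocalRing`, p830641: every non-zero `b` with `F(b) = 0`, `∇F(b) = 0` is a multiple of a listed vector).  What is left
is the one geometric input: every non-regular point has a finite blow-up depth (`D`-level for a blow-up tower `D`).

* ★★★ `isoHypPoint_hypersurface_of_finiteDepth` — **`F` a prime form over `K = K̄`, finitely many singular lines, finite depth at each non-regular point ⟹
  `IsoHypPoint K (m+2) V₊(F) ι`;**
* ★★★ `elnatO_hypersurface_of_finiteDepth` — **… ⟹ `ELNatConclusionO K (m+2) V₊(F) ι`** (characteristic `p`, the registered stubs' conclusion);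
* ★★ `elnatO_or_exists_infinite_depth_hypersurface` — the dichotomy for prime forms with finitely many singular lines.

Honest label: closes no registered stub; the per-class depth certificates (`Aₙ / Dₙ / Eₙ` charts: level `0` = cone vertices over smooth `V(Φ)` is
✓ `isoHypPoint_of_oneStepVertex`-type data; level `1` = `A₃, A₄, D₄`; …) are the remaining concrete work.

References: [Hartshorne1977, I Thm. 5.1, I Ex. 5.8, II Ex. 7.12]; [Matsumura1987, Thm. 14.2, Thm. 30.5]; [StacksProject, Tags 080E, 02OS] — through the cited tree files.
-/

set_option linter.dupNamespace false -- mandated namespace `Summit.<Summit>.<Problem>` of this single-conjunct summit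

noncomputable section

open CategoryTheory CategoryTheory.Limits AlgebraicGeometry TopologicalSpace
open MvPolynomial HomogeneousLocalization
open Literature.AlgebraicGeometry.Resolution Literature.AlgebraicGeometry.Motives Literature.AlgebraicGeometry.GroupSchemes
open Literature.AlgebraicGeometry.Motives.SmoothHypersurface Literature.AlgebraicGeometry.Motives.ProjectiveSpace
open AlgebraicGeometry.Scheme.IdealSheafData
open Summit.ResolutionOfSingularities.ResolutionOfSingularities.Cruxes.EquisingularLift.StrataSplit
open Summit.ResolutionOfSingularities.ResolutionOfSingularities.Theorems.EquisingularLift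

namespace Summit.ResolutionOfSingularities.ResolutionOfSingularities.Cruxes.EquisingularLiftNat.Sections

/-- ★★★ **PRIME FORM, FINITELY MANY SINGULAR LINES, FINITE BLOW-UP DEPTH ⟹ `IsoHypPoint`** (`K = K̄`, every dimension).  `F` a prime form of degree `d`;
`V` a finite set of vectors such that every non-zero `b` with `F(b) = 0`, `∇F(b) = 0` is a multiple of some `v ∈ V`; `D` a blow-up tower; every non-regular
point of `V₊(F)` of some `D`-level.  Then `IsoHypPoint K (m+2) V₊(F) ι` (✓ `SingLocus.finite_setOf_not_isRegularLocalRing` +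
✓ `isoHypPoint_of_finite_nonRegularLocus_tower`). [OURS] [cite: Hartshorne1977, I Thm. 5.1, I Ex. 5.8] [cite: StacksProject, Tag 080E] -/
theorem isoHypPoint_hypersurface_of_finiteDepth (K : Type) [Field K] [IsAlgClosed K] {m : ℕ} (F : MvPolynomial (Fin (m + 2 + 1)) K) {d : ℕ}
    (hF : F.IsHomogeneous d) (hFp : Prime F) (V : Finset (Fin (m + 2 + 1) → K))
    (hjac : ∀ b : Fin (m + 2 + 1) → K, b ≠ 0 → eval b F = 0 → (∀ i, eval b (pderiv i F) = 0) → ∃ v ∈ V, ∃ t : K, b = t • v)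
    (D : ℕ → ∀ Γ : Scheme.{0}, Γ → Prop)
    (hD0 : ∀ (Γ : Scheme.{0}) (y : Γ), IsClosed (({y} : Set Γ)) →
      (D 0 Γ y ↔ ∀ (hy : IsClosed (({y} : Set Γ))) (Z : Scheme.{0}) (τ : Z ⟶ Γ), IsBlowup τ (vanishingIdeal ⟨{y}, hy⟩) →
        ∀ z : Z, τ z = y → IsRegularLocalRing (Z.presheaf.stalk z)))
    (hDsucc : ∀ (d : ℕ) (Γ : Scheme.{0}) (y : Γ), IsClosed (({y} : Set Γ)) →
      (D (d + 1) Γ y ↔ ∀ (hy : IsClosed (({y} : Set Γ))) (Z : Scheme.{0}) (τ : Z ⟶ Γ), IsBlowup τ (vanishingIdeal ⟨{y}, hy⟩) →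
        ∃ S' : Finset Z, (∀ z : Z, τ z = y → z ∉ S' → IsRegularLocalRing (Z.presheaf.stalk z)) ∧
          ∀ z ∈ S', τ z = y ∧ IsClosed (({z} : Set Z)) ∧ ∃ d' ≤ d, D d' Z z))
    (hdepth : letI := MvPolynomial.gradedAlgebra (σ := Fin (m + 2 + 1)) (R := K)
      ∀ x : ↥(hypersurface F).left, ¬ IsRegularLocalRing ((hypersurface F).left.presheaf.stalk x) → ∃ d, D d (hypersurface F).left x) :
    letI := MvPolynomial.gradedAlgebra (σ := Fin (m + 2 + 1)) (R := K)
    IsoHypPoint K (m + 2) (hypersurface F).left (hypersurfaceι F).left := by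
  letI := MvPolynomial.gradedAlgebra (σ := Fin (m + 2 + 1)) (R := K)
  haveI := HypersurfaceSpecimen.isIntegral_hypersurface_of_prime K F hF hFp
  exact isoHypPoint_of_finite_nonRegularLocus_tower K (m + 2) (hypersurface F).left (hypersurfaceι F).left D hD0 hDsucc
    (SingLocus.finite_setOf_not_isRegularLocalRing K F hF hFp V hjac) hdepth

/-- ★★★ **PRIME FORM, FINITELY MANY SINGULAR LINES, FINITE BLOW-UP DEPTH ⟹ `ELNatConclusionO`** (`K = K̄` of characteristic `p`, every dimension) — the
registered stubs' conclusion for `H = V₊(F)` from polynomial data plus depth (`isoHypPoint_hypersurface_of_finiteDepth` ⟶ ✓ `elNatAt_of_isoHypPoint` with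
✓ `HypersurfaceSpecimen.locallyPrincipal_hypersurfaceι` ⟶ ✓ `RouteCurrency.elnatO_of_elNatAt`). [OURS] [cite: Hartshorne1977, I Thm. 5.1, II Example 7.1.1]
[cite: StacksProject, Tag 080E] -/
theorem elnatO_hypersurface_of_finiteDepth (p : ℕ) (hp : p.Prime) (K : Type) [Field K] [CharP K p] [IsAlgClosed K] {m : ℕ}
    (F : MvPolynomial (Fin (m + 2 + 1)) K) {d : ℕ} (hF : F.IsHomogeneous d) (hFp : Prime F) (V : Finset (Fin (m + 2 + 1) → K))
    (hjac : ∀ b : Fin (m + 2 + 1) → K, b ≠ 0 → eval b F = 0 → (∀ i, eval b (pderiv i F) = 0) → ∃ v ∈ V, ∃ t : K, b = t • v)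
    (D : ℕ → ∀ Γ : Scheme.{0}, Γ → Prop)
    (hD0 : ∀ (Γ : Scheme.{0}) (y : Γ), IsClosed (({y} : Set Γ)) →
      (D 0 Γ y ↔ ∀ (hy : IsClosed (({y} : Set Γ))) (Z : Scheme.{0}) (τ : Z ⟶ Γ), IsBlowup τ (vanishingIdeal ⟨{y}, hy⟩) →
        ∀ z : Z, τ z = y → IsRegularLocalRing (Z.presheaf.stalk z)))
    (hDsucc : ∀ (d : ℕ) (Γ : Scheme.{0}) (y : Γ), IsClosed (({y} : Set Γ)) →
      (D (d + 1) Γ y ↔ ∀ (hy : IsClosed (({y} : Set Γ))) (Z : Scheme.{0}) (τ : Z ⟶ Γ), IsBlowup τ (vanishingIdeal ⟨{y}, hy⟩) →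
        ∃ S' : Finset Z, (∀ z : Z, τ z = y → z ∉ S' → IsRegularLocalRing (Z.presheaf.stalk z)) ∧
          ∀ z ∈ S', τ z = y ∧ IsClosed (({z} : Set Z)) ∧ ∃ d' ≤ d, D d' Z z))
    (hdepth : letI := MvPolynomial.gradedAlgebra (σ := Fin (m + 2 + 1)) (R := K)
      ∀ x : ↥(hypersurface F).left, ¬ IsRegularLocalRing ((hypersurface F).left.presheaf.stalk x) → ∃ d, D d (hypersurface F).left x) :
    letI := MvPolynomial.gradedAlgebra (σ := Fin (m + 2 + 1)) (R := K)
    ELNatConclusionO K (m + 2) (hypersurface F).left (hypersurfaceι F).left := by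
  letI := MvPolynomial.gradedAlgebra (σ := Fin (m + 2 + 1)) (R := K)
  haveI := HypersurfaceSpecimen.isIntegral_hypersurface_of_prime K F hF hFp
  have hd : 0 < d := ConeN.pos_of_prime_of_isHomogeneous K F hF hFp
  exact RouteCurrency.elnatO_of_elNatAt p hp K (m + 2) (hypersurface F).left (hypersurfaceι F).left inferInstance inferInstance
    (elNatAt_of_isoHypPoint p hp K (m + 2) (hypersurface F).left (hypersurfaceι F).left inferInstance inferInstance
      (HypersurfaceSpecimen.locallyPrincipal_hypersurfaceι F hF hd (fun c => MultiOrd.radical_span_dehomogenize_eq_of_prime F hF hFp c))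
      (isoHypPoint_hypersurface_of_finiteDepth K F hF hFp V hjac D hD0 hDsucc hdepth))

/-- ★★ **THE DICHOTOMY FOR PRIME FORMS WITH FINITELY MANY SINGULAR LINES** (`K = K̄` of characteristic `p`; `D` any blow-up tower): `ELNatConclusionO` holds
for `V₊(F)`, or some non-regular point of `V₊(F)` has infinite intrinsic blow-up depth. [OURS] [cite: Hartshorne1977, I Thm. 5.1] [cite: StacksProject, Tag 080E] -/
theorem elnatO_or_exists_infinite_depth_hypersurface (p : ℕ) (hp : p.Prime) (K : Type) [Field K] [CharP K p] [IsAlgClosed K] {m : ℕ}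
    (F : MvPolynomial (Fin (m + 2 + 1)) K) {d : ℕ} (hF : F.IsHomogeneous d) (hFp : Prime F) (V : Finset (Fin (m + 2 + 1) → K))
    (hjac : ∀ b : Fin (m + 2 + 1) → K, b ≠ 0 → eval b F = 0 → (∀ i, eval b (pderiv i F) = 0) → ∃ v ∈ V, ∃ t : K, b = t • v)
    (D : ℕ → ∀ Γ : Scheme.{0}, Γ → Prop)
    (hD0 : ∀ (Γ : Scheme.{0}) (y : Γ), IsClosed (({y} : Set Γ)) →
      (D 0 Γ y ↔ ∀ (hy : IsClosed (({y} : Set Γ))) (Z : Scheme.{0}) (τ : Z ⟶ Γ), IsBlowup τ (vanishingIdeal ⟨{y}, hy⟩) →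
        ∀ z : Z, τ z = y → IsRegularLocalRing (Z.presheaf.stalk z)))
    (hDsucc : ∀ (d : ℕ) (Γ : Scheme.{0}) (y : Γ), IsClosed (({y} : Set Γ)) →
      (D (d + 1) Γ y ↔ ∀ (hy : IsClosed (({y} : Set Γ))) (Z : Scheme.{0}) (τ : Z ⟶ Γ), IsBlowup τ (vanishingIdeal ⟨{y}, hy⟩) →
        ∃ S' : Finset Z, (∀ z : Z, τ z = y → z ∉ S' → IsRegularLocalRing (Z.presheaf.stalk z)) ∧
          ∀ z ∈ S', τ z = y ∧ IsClosed (({z} : Set Z)) ∧ ∃ d' ≤ d, D d' Z z)) :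
    letI := MvPolynomial.gradedAlgebra (σ := Fin (m + 2 + 1)) (R := K)
    ELNatConclusionO K (m + 2) (hypersurface F).left (hypersurfaceι F).left ∨
      ∃ x : ↥(hypersurface F).left, ¬ IsRegularLocalRing ((hypersurface F).left.presheaf.stalk x) ∧ ∀ d : ℕ, ¬ D d (hypersurface F).left x := by
  letI := MvPolynomial.gradedAlgebra (σ := Fin (m + 2 + 1)) (R := K)
  by_cases h : ∀ x : ↥(hypersurface F).left, ¬ IsRegularLocalRing ((hypersurface F).left.presheaf.stalk x) → ∃ d, D d (hypersurface F).left x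
  · exact Or.inl (elnatO_hypersurface_of_finiteDepth p hp K F hF hFp V hjac D hD0 hDsucc h)
  · push Not at h
    exact Or.inr h

end Summit.ResolutionOfSingularities.ResolutionOfSingularities.Cruxes.EquisingularLiftNat.Sections

end
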